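import Mathlib.Analysis.SpecialFunctions.SmoothTransition
import Mathlib.Analysis.SpecialFunctions.JapaneseBracket
import Mathlib.Analysis.SpecialFunctions.Sqrt
import Mathlib.Analysis.Calculus.Deriv.Support
import Mathlib.Analysis.Normed.Group.Bounded
import HarnessLib

/-!
# Ingredients of the adapted weight of BD18 Lemma 3.1: cutoff, `⟨ξ⟩^{1/2}`, dyadic counting

Topic `Literature/Analysis/Fourier`. J. Bourgain, S. Dyatlov, *Spectral gaps without the pressure
condition*, Ann. of Math. 187 (2018), §3.1 builds a weight
`ω(ξ) = exp(-2⟨ξ⟩^{1/2}) ∏_n ∏_{J ∈ 𝒥_n} exp(-10 χ_J(ξ))` ((3.6) there) from a cutoff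
`χ ∈ C¹(ℝ; [0,1])`, `supp χ ⊂ [-1,1]`, `χ = 1` on `[-1/2, 1/2]`. This file supplies the elementary
ingredients (definitions with bodies + proved lemmas):

* `adaptedBump` — the cutoff `χ(x) = S(2 - 2x) S(2 + 2x)`, `S` = `Real.smoothTransition`: smooth,
  values in `[0,1]`, `= 1` on `[-1/2, 1/2]`, `= 0` off `(-1, 1)`, with bounded derivative;
* `japHalf ξ = √√(1+ξ²) = ⟨ξ⟩^{1/2}` — smooth, `≥ 1`, `|∂ japHalf| ≤ 1/2`,
  `japHalf/(1+ξ²)` integrable;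
* `card_dyadic_levels_le` — at most four `n` have `2^n ∈ (x/4, 4x)` (the multiplicity count
  "each `ξ` lies in at most 500 intervals `J̃`" of BD18 §3.1).
-/

namespace Literature.Analysis.Fourier

open Set Filter MeasureTheory

/-! ### The cutoff -/

/-- The cutoff `χ(x) = S(2 - 2x) · S(2 + 2x)` with `S = Real.smoothTransition`; a smooth substitute
for the `C¹` cutoff of BD18 §3.1 (`0 ≤ χ ≤ 1`, `supp χ ⊂ [-1,1]`, `χ = 1` on `[-1/2,1/2]`).
[cite: BourgainDyatlov2018, §3.1 (proof of Lemma 3.1)] -/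
noncomputable def adaptedBump (x : ℝ) : ℝ :=
  Real.smoothTransition (2 - 2 * x) * Real.smoothTransition (2 + 2 * x)

/-- `0 ≤ χ`. [cite: BourgainDyatlov2018, §3.1 (proof of Lemma 3.1)] -/
theorem adaptedBump_nonneg (x : ℝ) : 0 ≤ adaptedBump x :=
  mul_nonneg (Real.smoothTransition.nonneg _) (Real.smoothTransition.nonneg _)

/-- `χ ≤ 1`. [cite: BourgainDyatlov2018, §3.1 (proof of Lemma 3.1)] -/
theorem adaptedBump_le_one (x : ℝ) : adaptedBump x ≤ 1 :=
  mul_le_one₀ (Real.smoothTransition.le_one _) (Real.smoothTransition.nonneg _)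
    (Real.smoothTransition.le_one _)

/-- `χ = 1` on `[-1/2, 1/2]`. [cite: BourgainDyatlov2018, §3.1 (proof of Lemma 3.1)] -/
theorem adaptedBump_eq_one {x : ℝ} (hx : |x| ≤ 1 / 2) : adaptedBump x = 1 := by
  rw [abs_le] at hx
  unfold adaptedBump
  rw [Real.smoothTransition.one_of_one_le (by linarith),
    Real.smoothTransition.one_of_one_le (by linarith), one_mul]

/-- `χ = 0` off `(-1, 1)`. [cite: BourgainDyatlov2018, §3.1 (proof of Lemma 3.1)] -/
theorem adaptedBump_eq_zero {x : ℝ} (hx : 1 ≤ |x|) : adaptedBump x = 0 := by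
  unfold adaptedBump
  rcases le_abs'.1 hx with h | h
  · rw [Real.smoothTransition.zero_of_nonpos (x := 2 + 2 * x) (by linarith), mul_zero]
  · rw [Real.smoothTransition.zero_of_nonpos (x := 2 - 2 * x) (by linarith), zero_mul]

/-- `χ` is smooth. [cite: BourgainDyatlov2018, §3.1 (proof of Lemma 3.1)] -/
theorem contDiff_adaptedBump {n : ℕ∞} : ContDiff ℝ n adaptedBump := by
  unfold adaptedBump
  apply ContDiff.mul
  · exact Real.smoothTransition.contDiff.comp (contDiff_const.sub (contDiff_const.mul contDiff_id))
  · exact Real.smoothTransition.contDiff.comp (contDiff_const.add (contDiff_const.mul contDiff_id))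

/-- `χ` has compact support (in `[-1, 1]`). [cite: BourgainDyatlov2018, §3.1 (proof of Lemma 3.1)] -/
theorem hasCompactSupport_adaptedBump : HasCompactSupport adaptedBump := by
  apply HasCompactSupport.intro (isCompact_Icc (a := (-1 : ℝ)) (b := 1))
  intro x hx
  apply adaptedBump_eq_zero
  simp only [mem_Icc, not_and_or, not_le] at hx
  rcases hx with h | h
  · rw [abs_of_neg (by linarith)]; linarith
  · rw [abs_of_pos (by linarith)]; linarith

/-- The derivative of `χ` is bounded. [cite: BourgainDyatlov2018, §3.1 (proof of Lemma 3.1)] -/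
theorem exists_deriv_adaptedBump_bound : ∃ B : ℝ, 0 ≤ B ∧ ∀ x, |deriv adaptedBump x| ≤ B := by
  have hcont : Continuous (deriv adaptedBump) :=
    (contDiff_adaptedBump (n := 1)).continuous_deriv le_rfl
  obtain ⟨B, hB⟩ := hcont.bounded_above_of_compact_support hasCompactSupport_adaptedBump.deriv
  exact ⟨B, (abs_nonneg _).trans (by simpa using hB 0), fun x => by simpa using hB x⟩

/-- `∂χ = 0` off `[-1, 1]`. [cite: BourgainDyatlov2018, §3.1 (proof of Lemma 3.1)] -/
theorem deriv_adaptedBump_eq_zero {x : ℝ} (hx : 1 < |x|) : deriv adaptedBump x = 0 := by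
  have h : ∀ᶠ y in nhds x, adaptedBump y = (fun _ => (0 : ℝ)) y := by
    have hopen : IsOpen {y : ℝ | 1 < |y|} := isOpen_lt continuous_const continuous_abs
    filter_upwards [hopen.mem_nhds hx] with y hy
    exact adaptedBump_eq_zero (le_of_lt hy)
  rw [Filter.EventuallyEq.deriv_eq h, deriv_const]

/-! ### The weight `⟨ξ⟩^{1/2}` -/

/-- `japHalf ξ = √√(1 + ξ²) = ⟨ξ⟩^{1/2}` (BD18 §2.1: `⟨ξ⟩ = √(1+|ξ|²)`).
[cite: BourgainDyatlov2018, §3.1 (3.4)] -/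
noncomputable def japHalf (ξ : ℝ) : ℝ := Real.sqrt (Real.sqrt (1 + ξ ^ 2))

/-- `japHalf ξ = (1 + ξ²)^{1/4}`. [cite: BourgainDyatlov2018, §3.1 (3.4)] -/
theorem japHalf_eq_rpow (ξ : ℝ) : japHalf ξ = (1 + ξ ^ 2) ^ (1 / 4 : ℝ) := by
  have h1 : (0 : ℝ) ≤ 1 + ξ ^ 2 := by positivity
  rw [show (1 / 4 : ℝ) = (1 / 2) * (1 / 2) by norm_num, Real.rpow_mul h1,
    ← Real.sqrt_eq_rpow, ← Real.sqrt_eq_rpow]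
  rfl

/-- `1 ≤ japHalf ξ`. [cite: BourgainDyatlov2018, §3.1 (3.4)] -/
theorem one_le_japHalf (ξ : ℝ) : 1 ≤ japHalf ξ := by
  unfold japHalf
  rw [Real.one_le_sqrt, Real.one_le_sqrt]
  nlinarith

/-- `0 < japHalf ξ`. [cite: BourgainDyatlov2018, §3.1 (3.4)] -/
theorem japHalf_pos (ξ : ℝ) : 0 < japHalf ξ := lt_of_lt_of_le one_pos (one_le_japHalf ξ)

/-- The derivative of `japHalf`. [folklore] -/
theorem hasDerivAt_japHalf (ξ : ℝ) :
    HasDerivAt japHalf (ξ / (2 * Real.sqrt (1 + ξ ^ 2) * japHalf ξ)) ξ := by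
  have h1 : 0 < 1 + ξ ^ 2 := by positivity
  have h2 : 0 < Real.sqrt (1 + ξ ^ 2) := Real.sqrt_pos.2 h1
  have hu : HasDerivAt (fun x : ℝ => 1 + x ^ 2) (2 * ξ) ξ := by
    have := (hasDerivAt_pow 2 ξ).const_add 1
    simpa using this
  have hv : HasDerivAt (fun x : ℝ => Real.sqrt (1 + x ^ 2)) (2 * ξ / (2 * Real.sqrt (1 + ξ ^ 2))) ξ :=
    hu.sqrt h1.ne'
  have hw := hv.sqrt h2.ne'
  unfold japHalf
  convert hw using 1
  field_simp

/-- `|∂ japHalf| ≤ 1/2`. [folklore] -/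
theorem abs_deriv_japHalf_le (ξ : ℝ) : |deriv japHalf ξ| ≤ 1 / 2 := by
  rw [(hasDerivAt_japHalf ξ).deriv]
  have h1 : 0 < Real.sqrt (1 + ξ ^ 2) := Real.sqrt_pos.2 (by positivity)
  have h2 := japHalf_pos ξ
  have h3 : |ξ| ≤ Real.sqrt (1 + ξ ^ 2) := by
    rw [← Real.sqrt_sq_eq_abs]
    exact Real.sqrt_le_sqrt (by nlinarith)
  have hden : 0 < 2 * Real.sqrt (1 + ξ ^ 2) * japHalf ξ := mul_pos (mul_pos two_pos h1) h2
  rw [abs_div, abs_of_pos hden, div_le_iff₀ hden]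
  calc |ξ| ≤ Real.sqrt (1 + ξ ^ 2) * 1 := by rw [mul_one]; exact h3
    _ ≤ Real.sqrt (1 + ξ ^ 2) * japHalf ξ := mul_le_mul_of_nonneg_left (one_le_japHalf ξ) h1.le
    _ = 1 / 2 * (2 * Real.sqrt (1 + ξ ^ 2) * japHalf ξ) := by ring

/-- `japHalf` is `C¹` (indeed smooth). [folklore] -/
theorem contDiff_japHalf : ContDiff ℝ 1 japHalf := by
  rw [contDiff_one_iff_deriv]
  refine ⟨fun ξ => (hasDerivAt_japHalf ξ).differentiableAt, ?_⟩
  have : deriv japHalf = fun ξ => ξ / (2 * Real.sqrt (1 + ξ ^ 2) * japHalf ξ) :=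
    funext fun ξ => (hasDerivAt_japHalf ξ).deriv
  rw [this]
  unfold japHalf
  apply Continuous.div (by fun_prop) (by fun_prop)
  intro ξ
  have h1 : 0 < Real.sqrt (1 + ξ ^ 2) := Real.sqrt_pos.2 (by positivity)
  have h2 : 0 < Real.sqrt (Real.sqrt (1 + ξ ^ 2)) := Real.sqrt_pos.2 h1
  positivity

/-- `japHalf ξ / (1 + ξ²) = (1 + ξ²)^{-3/4}` is integrable. [folklore] -/
theorem integrable_japHalf_div : Integrable fun ξ : ℝ => japHalf ξ / (1 + ξ ^ 2) := by
  have h := integrable_rpow_neg_one_add_norm_sq (E := ℝ) (μ := volume) (r := 3 / 2)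
    (by rw [Module.finrank_self]; norm_num)
  refine h.congr (Eventually.of_forall fun ξ => ?_)
  simp only [Real.norm_eq_abs, sq_abs]
  rw [japHalf_eq_rpow, div_eq_mul_inv ((1 + ξ ^ 2) ^ (1 / 4 : ℝ)), ← Real.rpow_neg_one (1 + ξ ^ 2),
    ← Real.rpow_add (by positivity)]
  norm_num

/-! ### Dyadic counting -/

/-- At most four natural numbers `n` have `x/4 < 2^n < 4x`. [folklore] -/
theorem card_dyadic_levels_le {x : ℝ} (S : Finset ℕ)
    (hS : ∀ n ∈ S, x / 4 < (2 : ℝ) ^ n ∧ (2 : ℝ) ^ n < 4 * x) : S.card ≤ 4 := by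
  by_cases hne : S.Nonempty
  · set n₀ := S.min' hne with hn₀
    have hn₀S : n₀ ∈ S := Finset.min'_mem S hne
    have hsub : S ⊆ Finset.Icc n₀ (n₀ + 3) := by
      intro m hm
      rw [Finset.mem_Icc]
      refine ⟨Finset.min'_le S m hm, ?_⟩
      by_contra hcon
      push Not at hcon
      have h1 := (hS n₀ hn₀S).1
      have h2 := (hS m hm).2
      have h3 : (2 : ℝ) ^ (n₀ + 4) ≤ 2 ^ m := pow_le_pow_right₀ (by norm_num) (by omega)
      have h4 : (2 : ℝ) ^ (n₀ + 4) = 16 * 2 ^ n₀ := by rw [pow_add]; norm_num; ring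
      nlinarith
    calc S.card ≤ (Finset.Icc n₀ (n₀ + 3)).card := Finset.card_le_card hsub
      _ = 4 := by rw [Nat.card_Icc]; omega
  · rw [Finset.not_nonempty_iff_eq_empty.1 hne]
    simp

end Literature.Analysis.Fourier
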